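import Summits.BirchSwinnertonDyer.BirchSwinnertonDyer.Theses.InertBadSignedBranches
import Summits.BirchSwinnertonDyer.BirchSwinnertonDyer.Theorems.InertBadSignedBranchesInertBadAtThreeIstarZeroOfPublishedFacts
import Summits.BirchSwinnertonDyer.BirchSwinnertonDyer.Theorems.InertBadSignedBranchesCccOneLawOnTypeIstarZeroOfLowerHalf
import Summits.BirchSwinnertonDyer.BirchSwinnertonDyer.Theorems.InertBadSignedBranchesInertBadAtThreeIstarZeroOfLowerHalf
import HarnessLib

/-!
# Route `InertBadSignedBranches` (rung K8), D71 child `InertBadAtThreeIstarZero`: CONTENT DISCLOSURE at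
# `p = 3` — modulo the readings at `3` and `PublishedFactsInert` the child IS C-cc-1@3 (pair form on the
# type), and modulo the upper-half facts + the Manin datum at `3` both ARE `LowerHalfOnType 3 I₀*`
# (helper toward stmt-BirchSwinnertonDyer-19656; cell `bsd-cm`, seat `bsd-cm-k8i-c41`; theorems only)

HONEST FRAMING (cell `bsd-cm`, run/shared/lean/pub/bsd-cm/): Birch–Swinnerton-Dyer is NOT proved by
any of this. The item `InertBadAtThreeIstarZero` (the `3`-part of BSD for every globally minimal CM
curve of signed local type `(3, I₀*)` and analytic rank one) is OPEN; every theorem below is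
CONDITIONAL on displayed hypotheses and closes nothing; the class served (O10-PS@3, 57 classes
`N < 5·10⁵`) stays CONSTRUCTION-SHAPED and OPEN. THEOREMS ONLY: 0 definitions, 0 named facts minted,
0 `sorry`; no label or mark moves.

PARTITION (D-0054): CornerF inert-bad (B12 / O10) × O10-PS@3 (57 rank-one classes of signed local type
`(3, I₀*)`) × `p = 3` — types-the-object-of (content disclosure of the child; closes no cell).

## What this file adds (the `p = 3` completion of inert g11's p415634 (ii)–(iv))

The kernel holds two normal forms of the child: the signed-branch one (x1b p415789 / inert g10:
child ⟸ law@3 ∧ (C1_η)@3 ∧ readings@3 ∧ `PublishedFactsInert`) and the Kolyvagin-side one (inert g11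
p416932: child ⟸ `LowerHalfOnType 3 I₀*` ∧ the eight upper-half facts ∧ the Manin datum at `3`). Both
were ONE-WAY. Here:

* §1 `pairValuation_of_bsdp_of_readings_of_ne_two` — per pair at any ODD `p`: `BSD(W, p)` + the exact
  Kobayashi-7.4 reading + (R2) + Poitou–Tate + GZK + modularity + (C1_η) at the twin ⟹ the C-cc-1
  VALUES at the pair (`coeff₁ L ≠ 0 ∧ v_p(coeff₁ L) = 2n + ord_p(q·Tam/#tors²)`), the converse of inert
  g10's `InertBadOdd.bsdp_of_pairValuation_of_readings_of_ne_two` (non-vanishing by inert g11's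
  `CccOneLowerHalf.coeff_one_ne_zero_of_exactReading`; valuation by x1b's discharged strict-Selmer
  index and the exact-control value — g0's `valuation_coeff_one_eq_of_bsdp_of_exactControl` with
  `5 ≤ p` ↦ `p ≠ 2` + `ord_p c_p(W) = 0`);
* §2 `pairLawAtThree_of_inertBadAtThreeIstarZero_of_readingsAtThree` and
  **`inertBadAtThreeIstarZero_iff_pairLawAtThree (h₅ : readings@3) (h₆ : PublishedFactsInert) :
  InertBadAtThreeIstarZero ↔ C-cc-1@3 (pair form on the type)`** — modulo the readings at `3` and the
  route's published facts the child IS the law at `3`: filing "law@3" as a separate crux is a change of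
  currency (GZ currency), not a weakening (the same T1R honesty inert g11 recorded for the crux 19223 at
  `p ≥ 5`, `cccOneLawOnTypeIstarZero_iff_bsdpOnType`);
* §3 **`pairLawAtThree_iff_lowerHalfOnType_three`** — modulo readings@3 ∧ `PublishedFactsInert` ∧ the
  eight upper-half facts ∧ the Manin datum on the type at `3`: C-cc-1@3 (pair form on the type) ↔
  `X12.O10.LowerHalfOnType 3 I₀*` — the `p = 3` twin of inert g11's
  `cccOneLawAt_iff_lowerHalfOnType_of_seven_lt` (there Manin-free at `p ≥ 11` by Edixhoven; at the
  additive prime `3` the Manin datum stays displayed: Mazur needs semistability at `p`, Edixhoven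
  `p > 7`), and `inertBadAtThreeIstarZero_iff_lowerHalfOnType_three` (the child ↔ the class target,
  modulo GZK + the upper-half facts + Manin@3).

So the three `p = 3` statements {child 19656, law@3 in pair form, `LowerHalfOnType 3 I₀*`} are ONE open
statement in three currencies modulo displayed print-shaped inputs; what is missing in print is the
η-branch `3`-adic Gross–Zagier formula (law side) = the main-conjecture half of `BSD₃` on the type
(Kolyvagin side). Nothing booked; nothing filed (D-0014).

References (locators only): [Kobayashi2003] §4 (p. 8), Thm. 7.4 (p. 13), Thm. 9.3 (p. 26);
[KitajimaOtsuki2018] Main Thm. 1.3; [GreenbergLNM1716] §2 (pp. 62–63), §4 Thm. 4.1; [MilneADT2006]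
I.4.10; [MatarNekovar2019] Thm. 0.3, §0.11; [Mazur1978] Cor. 4.1; [EdixhovenManin1991] Thm. 3;
[Miller2011LMS] §1, Def. 1.1; [SilvermanATAEC1994] IV.9.4, Table 4.1.
-/

set_option autoImplicit false
set_option linter.dupNamespace false

noncomputable section

open scoped Classical MatrixGroups ModularForm NumberField

open CongruenceSubgroup Field NumberField IsDedekindDomain IsDedekindDomain.HeightOneSpectrum
  WeierstrassCurve Rat.HeightOneSpectrum
open Literature.NumberTheory.EllipticCurves
open Literature.NumberTheory.EllipticCurves.ModularForms
open Literature.NumberTheory.EllipticCurves.Kobayashi2003 hiding IsQuadraticBranchMinusLFunction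
open Literature.NumberTheory.EllipticCurves.Rank1Residual
open Literature.NumberTheory.EllipticCurves.Rank1Residual.Typed
open Literature.NumberTheory.GaloisRepresentations
open Literature.NumberTheory.GaloisCohomology
open Summit.BirchSwinnertonDyer.Rank1Residual
open Summit.BirchSwinnertonDyer.Rank1Residual.Additive
open Summit.BirchSwinnertonDyer.Rank1Residual.Additive.LocalLog
open Summit.BirchSwinnertonDyer.Rank1Residual.X12.O10
open Summit.BirchSwinnertonDyer.BirchSwinnertonDyer.Theses.InertBadSignedBranches
open Summit.BirchSwinnertonDyer.BirchSwinnertonDyer.Theorems.InertBadOdd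
open Summit.BirchSwinnertonDyer.BirchSwinnertonDyer.Theorems.CccOneLowerHalf
open Summit.BirchSwinnertonDyer.BirchSwinnertonDyer.Theorems.InertBadOddLowerHalf

namespace Summit.BirchSwinnertonDyer.BirchSwinnertonDyer.Theorems.InertBadAtThreeIff

/-! ## §1 Per pair at any odd `p`: the C-cc-1 values FROM `BSD(W, p)` and the readings -/

section Pair

variable (W : WeierstrassCurve ℚ) [W.IsElliptic] [W.IsGloballyMinimal] {p : ℕ} [hp : Fact p.Prime]
  {V : WeierstrassCurve ℚ} [V.IsElliptic] [V.IsGloballyMinimal] {C : VariableChange ℚ}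
  {N : ℕ} [NeZero N] {f : CuspForm (Gamma0 N) 2} {ϖ : ℚ} {L : IwasawaAlgebra p}
  {P : W.toAffine.Point} {n : ℕ}

/-- **The C-cc-1 VALUES at a pair `(W, p)`, `p` odd, FROM `BSD(W, p)` and the readings**: given
modularity (`hmod`), Poitou–Tate (`hPT`), GZK (`hGZK`), the typed reading (R2)
(`OddBranchStrictMinusNoFiniteSubmoduleAt W p`), the EXACT Kobayashi-7.4 reading `h74x` on `W`,
`ord_p c_p(W) = 0`, a good `a_p = 0` twin datum `C • W^{(p*)} = V` with (C1_η) at `V`, its newform and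
period ratio, a branch function `L`, `W(ℚ_p)[p] = 0`, a generator `P` of `p`-divisibility level `n`,
`r_an(W) = 1`, and Miller's `BSD(W, p)`: for every rational `q` with `#Ш_an(W) = q`,
`coeff₁ L ≠ 0 ∧ v_p(coeff₁ L) = 2n + ord_p(q·Tam(W)/#W(ℚ)_tors²)`. Non-vanishing: inert g11's
`coeff_one_ne_zero_of_exactReading`; valuation: inert g10's exact-control value
`ord_p #Sel_str + n + ord_p(Tam/#tors²) = v_p(coeff₁ L)`, x1b's discharged index
`ord_p #Sel_str = n + ord_p #Ш[p^∞]`, and `BSD(W,p)`: `ord_p #Ш[p^∞] = ord_p q`. The converse of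
`InertBadOdd.bsdp_of_pairValuation_of_readings_of_ne_two`. CONDITIONAL; nothing booked.
[cite: Kobayashi2003, §4 (p. 8), Thm. 7.4 (p. 13), Thm. 9.3 (p. 26)] [cite: GreenbergLNM1716, §2 (pp. 62–63)]
[cite: MilneADT2006, Ch. I, Thm. 4.10] [cite: Miller2011LMS, §1 and Def. 1.1] -/
theorem pairValuation_of_bsdp_of_readings_of_ne_two (hmod : hasEntireLFunction_rat)
    (hPT : poitouTate_selmerStructure_duality_real ℚ)
    (hGZK : rank_eq_analyticRank_of_analyticRank_le_one)
    (hR2 : OddBranchStrictMinusNoFiniteSubmoduleAt W p)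
    (h74x : ∀ (V : WeierstrassCurve ℚ) [V.IsElliptic] [V.IsGloballyMinimal] (C : VariableChange ℚ)
        {N : ℕ} [NeZero N] {f : CuspForm (Gamma0 N) 2},
        p ≠ 2 → C • W.quadraticTwist ((-1) ^ (p / 2) * p) = V →
        V.HasGoodReductionAtPrime p → V.frobeniusTrace p = 0 →
        QuadraticBranchPlusMainConjectureAt V p → IsNewformOf V f →
        ∀ (ϖ : ℚ), (if Even (p / 2) then (ϖ : ℝ) * V.realPeriodRat = plusPeriod f
            else (ϖ : ℝ) * V.imaginaryPeriodRat = minusPeriod f) →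
        ∀ (Lη : IwasawaAlgebra p), IsQuadraticBranchMinusLFunction f p ϖ Lη →
        ∀ (κ : ZpExtension ℚ p) (γ : Field.absoluteGaloisGroup ℚ),
          κ.IsCyclotomic → κ.IsTopGenerator γ → IsCyclotomicVariable p γ →
        ∀ (D : StrictSignedSelmerDualData W κ ℚ_[p] γ (-1)) (L' : IwasawaAlgebra p),
          Lη = PowerSeries.X * L' → D.charIdeal = Ideal.span {L'})
    (hp2 : p ≠ 2)
    (hv0 : padicValNat p ((W.baseChange (((primesEquiv (R := 𝓞 ℚ)).symm ⟨p, hp.out⟩).adicCompletion ℚ)).localTamagawaNumber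
      (((primesEquiv (R := 𝓞 ℚ)).symm ⟨p, hp.out⟩).adicCompletionIntegers ℚ)) = 0)
    (hCV : C • W.quadraticTwist ((-1) ^ (p / 2) * p) = V)
    (hgood : V.HasGoodReductionAtPrime p) (hap : V.frobeniusTrace p = 0)
    (h1 : QuadraticBranchPlusMainConjectureAt V p) (hf : IsNewformOf V f)
    (hϖ : if Even (p / 2) then (ϖ : ℝ) * V.realPeriodRat = plusPeriod f
        else (ϖ : ℝ) * V.imaginaryPeriodRat = minusPeriod f)
    (hL : IsQuadraticBranchMinusLFunction f p ϖ L)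
    (htors : ∀ Q : (W.baseChange ℚ_[p]).toAffine.Point, p • Q = 0 → Q = 0)
    (hP : ¬ IsOfFinAddOrder P)
    (hgen : ∀ R : W.toAffine.Point, ∃ (k : ℤ) (T : W.toAffine.Point),
      IsOfFinAddOrder T ∧ R = k • P + T)
    (hdiv : ∃ Q : (W.baseChange ℚ_[p]).toAffine.Point, p ^ n • Q = W.toPadicPoint p P)
    (hndiv : ∀ Q : (W.baseChange ℚ_[p]).toAffine.Point, p ^ (n + 1) • Q ≠ W.toPadicPoint p P)
    (hr : W.analyticRank = 1) (hB : BSDp W p) :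
    ∀ q : ℚ, shaAn W = (q : ℂ) →
      PowerSeries.coeff 1 L ≠ 0 ∧
        ((PowerSeries.coeff 1 L : ℤ_[p]) : ℚ_[p]).valuation =
          2 * (n : ℤ) + padicValRat p (q * W.tamagawaProduct / (W.torsionOrder : ℚ) ^ 2) := by
  intro q hq
  obtain ⟨-, hfin, s, hs, hval⟩ := hB
  haveI : Finite (AddCommGroup.primaryComponent W.sha p) := hfin
  -- `q = s`: both are `#Ш_an(W)`
  have hqs : q = s := by
    have : ((q : ℂ)) = (s : ℂ) := by rw [← hq, hs]
    exact_mod_cast this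
  subst hqs
  have hq0 : q ≠ 0 := by
    rintro rfl
    exact AdditivePotMult.shaAn_ne_zero W hmod (by rw [hq, Rat.cast_zero])
  -- the non-vanishing clause from the exact reading at the twin datum
  have hne : PowerSeries.coeff 1 L ≠ 0 :=
    coeff_one_ne_zero_of_exactReading W p hPT hp2 C hCV hgood hap hL hP hgen hdiv hndiv
      fun κ γ hκ hγ hγc D L' hLL' ↦ h74x V C hp2 hCV hgood hap h1 hf ϖ hϖ L hL κ γ hκ hγ hγc D L' hLL'
  refine ⟨hne, ?_⟩
  -- the exact-control value and the discharged index
  obtain ⟨-, hv3⟩ := exactControlValue_of_readings_of_ne_two W hPT hGZK hR2 h74x hp2 hv0 hCV hgood hap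
    hr h1 hf hϖ hL htors hP hgen hdiv hndiv
  have hI := (StrictSha.strictSelmerIndexAt_holds W p).padicValNat_card_eq hP hgen htors hdiv hndiv
  rw [hI, Nat.cast_add] at hv3
  have hc : (W.tamagawaProduct : ℚ) ≠ 0 := by exact_mod_cast W.tamagawaProduct_pos_holds.ne'
  have ht : (W.torsionOrder : ℚ) ≠ 0 := by exact_mod_cast W.torsionOrder_pos_holds.ne'
  have hct : (W.tamagawaProduct : ℚ) / (W.torsionOrder : ℚ) ^ 2 ≠ 0 :=
    div_ne_zero hc (pow_ne_zero 2 ht)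
  have hsplit : padicValRat p (q * W.tamagawaProduct / (W.torsionOrder : ℚ) ^ 2) =
      padicValRat p q + padicValRat p ((W.tamagawaProduct : ℚ) / (W.torsionOrder : ℚ) ^ 2) := by
    rw [mul_div_assoc, padicValRat.mul hq0 hct]
  rw [hsplit, hval, ← hv3]
  push_cast
  ring

end Pair

/-! ## §2 Class level at `p = 3`: the child ⟹ the law at `3` (pair form on the type), and the `iff` -/

/-- **C-cc-1@3 in pair form on the type FROM the child `InertBadAtThreeIstarZero`** (`h`), given
modularity, GZK, Poitou–Tate and the readings binder at `3` (`h₅`: (C1_η)@3 on the CM good-inert curves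
∧ for every `W` of type `(3, I₀*)` with `r_an = 1`: (R2)@3 ∧ the exact Kobayashi-7.4 reading at `3` —
the SAME binder as x1b's `…_of_pairLawAtThree_of_readingsAtThree`). Per `W`: the child gives
`Typed.X12.MissingInputAt W 3`, `3` is not split on the type, so `MissingPPartAt W 3`, so `BSD(W, 3)`
(GZK); `ord₃ c₃(W) = 0` (inert g10's CM Tamagawa lemma) and (C1_η) at the twin (`j`-invariance); then
§1. CONDITIONAL; nothing booked. [cite: Kobayashi2003, §4 (p. 8), Thm. 7.4 (p. 13)]
[cite: SilvermanATAEC1994, IV.9.4 and Table 4.1] [cite: Miller2011LMS, §1 and Def. 1.1] -/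
theorem pairLawAtThree_of_inertBadAtThreeIstarZero_of_readingsAtThree (hmod : hasEntireLFunction_rat)
    (hGZK : rank_eq_analyticRank_of_analyticRank_le_one)
    (hPT : poitouTate_selmerStructure_duality_real ℚ)
    (h₅ : (∀ (V : WeierstrassCurve ℚ) [V.IsElliptic] [V.IsGloballyMinimal], V.HasCM →
        V.HasGoodReductionAtPrime 3 → CMInert V 3 → QuadraticBranchPlusMainConjectureAt V 3) ∧
      ∀ (W : WeierstrassCurve ℚ) [W.IsElliptic] [W.IsGloballyMinimal],
        HasSignedLocalType W 3 (.Istar 0) → W.analyticRank = 1 →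
        OddBranchStrictMinusNoFiniteSubmoduleAt W 3 ∧
        ∀ (V : WeierstrassCurve ℚ) [V.IsElliptic] [V.IsGloballyMinimal] (C : VariableChange ℚ)
          {N : ℕ} [NeZero N] {f : CuspForm (Gamma0 N) 2},
          (3 : ℕ) ≠ 2 → C • W.quadraticTwist (-3) = V →
          V.HasGoodReductionAtPrime 3 → V.frobeniusTrace 3 = 0 →
          QuadraticBranchPlusMainConjectureAt V 3 → IsNewformOf V f →
          ∀ (ϖ : ℚ), (ϖ : ℝ) * V.imaginaryPeriodRat = minusPeriod f →
          ∀ (Lη : IwasawaAlgebra 3), IsQuadraticBranchMinusLFunction f 3 ϖ Lη →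
          ∀ (κ : ZpExtension ℚ 3) (γ : Field.absoluteGaloisGroup ℚ),
            κ.IsCyclotomic → κ.IsTopGenerator γ → IsCyclotomicVariable 3 γ →
          ∀ (D : StrictSignedSelmerDualData W κ ℚ_[3] γ (-1)) (L' : IwasawaAlgebra 3),
            Lη = PowerSeries.X * L' → D.charIdeal = Ideal.span {L'})
    (h : Summit.BirchSwinnertonDyer.BirchSwinnertonDyer.Theses.InertBadSignedBranches.InertBadAtThreeIstarZero) :
    ∀ (W : WeierstrassCurve ℚ) [W.IsElliptic] [W.IsGloballyMinimal],
      HasSignedLocalType W 3 (.Istar 0) → W.analyticRank = 1 →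
      ∀ (V : WeierstrassCurve ℚ) [V.IsElliptic] [V.IsGloballyMinimal] (C : VariableChange ℚ)
        {N : ℕ} [NeZero N] {f : CuspForm (Gamma0 N) 2},
        C • W.quadraticTwist (-3) = V →
        V.HasGoodReductionAtPrime 3 → V.frobeniusTrace 3 = 0 → IsNewformOf V f →
        ∀ (ϖ : ℚ), (ϖ : ℝ) * V.imaginaryPeriodRat = minusPeriod f →
        ∀ (L : IwasawaAlgebra 3), IsQuadraticBranchMinusLFunction f 3 ϖ L →
        (∀ Q : (W.baseChange ℚ_[3]).toAffine.Point, 3 • Q = 0 → Q = 0) →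
        ∀ (P : W.toAffine.Point) (n : ℕ), ¬ IsOfFinAddOrder P →
        (∀ R : W.toAffine.Point, ∃ (k : ℤ) (T : W.toAffine.Point), IsOfFinAddOrder T ∧ R = k • P + T) →
        (∃ Q : (W.baseChange ℚ_[3]).toAffine.Point, 3 ^ n • Q = W.toPadicPoint 3 P) →
        (∀ Q : (W.baseChange ℚ_[3]).toAffine.Point, 3 ^ (n + 1) • Q ≠ W.toPadicPoint 3 P) →
        ∀ (q : ℚ), shaAn W = (q : ℂ) →
        PowerSeries.coeff 1 L ≠ 0 ∧
          ((PowerSeries.coeff 1 L : ℤ_[3]) : ℚ_[3]).valuation =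
            2 * (n : ℤ) + padicValRat 3 (q * W.tamagawaProduct / (W.torsionOrder : ℚ) ^ 2) := by
  have h32 : ((-1 : ℚ) ^ (3 / 2) * (3 : ℕ)) = -3 := by norm_num
  have hodd : ¬ Even (3 / 2) := by decide
  obtain ⟨hC1, hRd⟩ := h₅
  intro W _ _ hT hr V _ _ C N _ f hC hgood hap hf ϖ hϖ L hL htors P n hP hgen hdiv hndiv q hq
  -- the child at `W`: `MissingInputAt W 3`, hence `BSD(W, 3)`
  have hmi : X12.MissingInputAt W 3 := by
    have h' := h
    unfold Summit.BirchSwinnertonDyer.BirchSwinnertonDyer.Theses.InertBadSignedBranches.InertBadAtThreeIstarZero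
      at h'
    exact h' W hT hr
  have hPP : MissingPPartAt W 3 :=
    hmi fun hs ↦ not_cmSplit_of_hasSignedLocalType W 3 hT hs.2
  have hB : BSDp W 3 := bsdp_of_missingPPartAt W 3 hGZK (by rw [hr]) hPP
  -- the readings and side data at `W`
  obtain ⟨hR2, h74x⟩ := hRd W hT hr
  have hC' : C • W.quadraticTwist ((-1 : ℚ) ^ (3 / 2) * (3 : ℕ)) = V := by rw [h32]; exact hC
  obtain ⟨hCM, hin⟩ := hasCM_and_cmInert_of_twist W 3 hT C hC'
  have hv0 := padicValNat_localTamagawaNumber_eq_zero_of_hasCM_three W hT.1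
    (not_cmRamified_of_hasSignedLocalType W 3 hT)
  refine pairValuation_of_bsdp_of_readings_of_ne_two W hmod hPT hGZK hR2 ?_ (by decide) hv0 hC' hgood hap
    (hC1 V hCM hgood hin) hf (by rw [if_neg hodd]; exact hϖ) hL htors hP hgen hdiv hndiv hr hB q hq
  intro V' _ _ C' N' _ f' hp2 hCV' hgood' hap' h1' hf' ϖ' hϖ' Lη hLη κ γ hκ hγ hγc D L' hLL'
  rw [h32] at hCV'
  rw [if_neg hodd] at hϖ'
  exact h74x V' C' hp2 hCV' hgood' hap' h1' hf' ϖ' hϖ' Lη hLη κ γ hκ hγ hγc D L' hLL'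

/-- **CONTENT DISCLOSURE: modulo the readings at `3` (`h₅`) and the route's support item
`PublishedFactsInert` (`h₆`), the child `InertBadAtThreeIstarZero` IS C-cc-1@3 in pair form on the type.**
(←) is x1b's `inertBadSignedBranches_inertBadAtThreeIstarZero_of_pairLawAtThree_of_readingsAtThree`
(p415789); (→) is the previous theorem. So a separate "law@3" crux would be the child in Gross–Zagier
currency, not strictly below it, once the readings are granted. CONDITIONAL equivalence; nothing booked.
[cite: Kobayashi2003, §4 (p. 8), Thm. 7.4 (p. 13)] [cite: Mazur1978, Cor. 4.1] [cite: Miller2011LMS, §1 and Def. 1.1] -/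
theorem inertBadAtThreeIstarZero_iff_pairLawAtThree
    (h₅ : (∀ (V : WeierstrassCurve ℚ) [V.IsElliptic] [V.IsGloballyMinimal], V.HasCM →
        V.HasGoodReductionAtPrime 3 → CMInert V 3 → QuadraticBranchPlusMainConjectureAt V 3) ∧
      ∀ (W : WeierstrassCurve ℚ) [W.IsElliptic] [W.IsGloballyMinimal],
        HasSignedLocalType W 3 (.Istar 0) → W.analyticRank = 1 →
        OddBranchStrictMinusNoFiniteSubmoduleAt W 3 ∧
        ∀ (V : WeierstrassCurve ℚ) [V.IsElliptic] [V.IsGloballyMinimal] (C : VariableChange ℚ)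
          {N : ℕ} [NeZero N] {f : CuspForm (Gamma0 N) 2},
          (3 : ℕ) ≠ 2 → C • W.quadraticTwist (-3) = V →
          V.HasGoodReductionAtPrime 3 → V.frobeniusTrace 3 = 0 →
          QuadraticBranchPlusMainConjectureAt V 3 → IsNewformOf V f →
          ∀ (ϖ : ℚ), (ϖ : ℝ) * V.imaginaryPeriodRat = minusPeriod f →
          ∀ (Lη : IwasawaAlgebra 3), IsQuadraticBranchMinusLFunction f 3 ϖ Lη →
          ∀ (κ : ZpExtension ℚ 3) (γ : Field.absoluteGaloisGroup ℚ),
            κ.IsCyclotomic → κ.IsTopGenerator γ → IsCyclotomicVariable 3 γ →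
          ∀ (D : StrictSignedSelmerDualData W κ ℚ_[3] γ (-1)) (L' : IwasawaAlgebra 3),
            Lη = PowerSeries.X * L' → D.charIdeal = Ideal.span {L'})
    (h₆ : PublishedFactsInert) :
    Summit.BirchSwinnertonDyer.BirchSwinnertonDyer.Theses.InertBadSignedBranches.InertBadAtThreeIstarZero ↔
      ∀ (W : WeierstrassCurve ℚ) [W.IsElliptic] [W.IsGloballyMinimal],
        HasSignedLocalType W 3 (.Istar 0) → W.analyticRank = 1 →
        ∀ (V : WeierstrassCurve ℚ) [V.IsElliptic] [V.IsGloballyMinimal] (C : VariableChange ℚ)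
          {N : ℕ} [NeZero N] {f : CuspForm (Gamma0 N) 2},
          C • W.quadraticTwist (-3) = V →
          V.HasGoodReductionAtPrime 3 → V.frobeniusTrace 3 = 0 → IsNewformOf V f →
          ∀ (ϖ : ℚ), (ϖ : ℝ) * V.imaginaryPeriodRat = minusPeriod f →
          ∀ (L : IwasawaAlgebra 3), IsQuadraticBranchMinusLFunction f 3 ϖ L →
          (∀ Q : (W.baseChange ℚ_[3]).toAffine.Point, 3 • Q = 0 → Q = 0) →
          ∀ (P : W.toAffine.Point) (n : ℕ), ¬ IsOfFinAddOrder P →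
          (∀ R : W.toAffine.Point, ∃ (k : ℤ) (T : W.toAffine.Point),
            IsOfFinAddOrder T ∧ R = k • P + T) →
          (∃ Q : (W.baseChange ℚ_[3]).toAffine.Point, 3 ^ n • Q = W.toPadicPoint 3 P) →
          (∀ Q : (W.baseChange ℚ_[3]).toAffine.Point, 3 ^ (n + 1) • Q ≠ W.toPadicPoint 3 P) →
          ∀ (q : ℚ), shaAn W = (q : ℂ) →
          PowerSeries.coeff 1 L ≠ 0 ∧
            ((PowerSeries.coeff 1 L : ℤ_[3]) : ℚ_[3]).valuation =
              2 * (n : ℤ) + padicValRat 3 (q * W.tamagawaProduct / (W.torsionOrder : ℚ) ^ 2) := by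
  refine ⟨fun h ↦ ?_, fun hlaw ↦ ?_⟩
  · obtain ⟨hmod, -, hGZK, hPT, -, -⟩ := h₆
    exact pairLawAtThree_of_inertBadAtThreeIstarZero_of_readingsAtThree hmod hGZK hPT h₅ h
  · exact inertBadSignedBranches_inertBadAtThreeIstarZero_of_pairLawAtThree_of_readingsAtThree hlaw h₅
      h₆

/-! ## §3 Both normal forms are `LowerHalfOnType 3 I₀*` (modulo the Manin datum at `3`) -/

/-- **The child ↔ the class target `X12.O10.LowerHalfOnType 3 I₀*`, modulo GZK, the eight published facts
of the every-curve upper half at `3` and the Manin datum on the type** (`hManin`, inert g11's binder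
verbatim: per pair Cremona's table, no class-level theorem at the additive prime `3`). (→): the child
gives `BSD(W, 3)` on the type (GZK), hence the lower half (`lowerHalfOnType_of_forall_bsdp`); (←): inert
g11's `InertBadOddLowerHalf.inertBadAtThreeIstarZero_of_lowerHalfOnType_three` (p416932). CONDITIONAL
equivalence; nothing booked; 19656 / O10@3 stay OPEN. [cite: MatarNekovar2019, Thm. 0.3 and §0.11]
[cite: Miller2011LMS, §1 and Def. 1.1] [cite: SilvermanATAEC1994, IV.9.4 and Table 4.1] -/
theorem inertBadAtThreeIstarZero_iff_lowerHalfOnType_three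
    (hGZ : ∀ (N : ℕ) [NeZero N] (W : WeierstrassCurve ℚ) (K : Type) [Field K] [NumberField K],
      gross_zagier N W K)
    (hKo : ∀ (N : ℕ) [NeZero N] (W : WeierstrassCurve ℚ) (K : Type) [Field K] [NumberField K],
      kolyvagin N W K)
    (hMN : ∀ (N : ℕ) [NeZero N] (W : WeierstrassCurve ℚ) (K : Type) [Field K] [NumberField K],
      MatarNekovar2019.thm03_padicValNat_card_sha_le_of_irreducible N W K)
    (hGZK : rank_eq_analyticRank_of_analyticRank_le_one) (hmod : hasEntireLFunction_rat)
    (hnf : exists_isNewformOf) (hFH : friedbergHoffstein_exists_heegnerField_split_twist_ne_zero)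
    (hCM8 : bsdTriple_of_hasCM_of_L_one_ne_zero)
    (hManin : ∀ (W : WeierstrassCurve ℚ) [W.IsElliptic] [W.IsGloballyMinimal] [Fact (Nat.Prime 3)]
      [NeZero (W.conductorNorm ℤ)], HasSignedLocalType W 3 (.Istar 0) → W.analyticRank = 1 →
      ∃ D : ModularParametrizationData W (W.conductorNorm ℤ), ¬ (3 : ℤ) ∣ D.c) :
    Summit.BirchSwinnertonDyer.BirchSwinnertonDyer.Theses.InertBadSignedBranches.InertBadAtThreeIstarZero ↔
      LowerHalfOnType 3 (.Istar 0) := by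
  refine ⟨fun h ↦ lowerHalfOnType_of_forall_bsdp hGZK fun W _ _ hT hr ↦ ?_, fun hlow ↦ ?_⟩
  · have h' := h
    unfold Summit.BirchSwinnertonDyer.BirchSwinnertonDyer.Theses.InertBadSignedBranches.InertBadAtThreeIstarZero
      at h'
    exact bsdp_of_missingPPartAt W 3 hGZK (by rw [hr])
      (h' W hT hr fun hs ↦ not_cmSplit_of_hasSignedLocalType W 3 hT hs.2)
  · exact inertBadAtThreeIstarZero_of_lowerHalfOnType_three hGZ hKo hMN hGZK hmod hnf hFH hCM8 hManin hlow

/-- **C-cc-1@3 (pair form on the type) ↔ `X12.O10.LowerHalfOnType 3 I₀*`**, modulo the readings at `3`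
(`h₅`), `PublishedFactsInert` (`h₆`), the published facts of the every-curve upper half at `3` (`hGZ hKo
hMN hFH hCM8`) and the Manin datum on the type (`hManin`) — the `p = 3` twin of inert g11's
`cccOneLawAt_iff_lowerHalfOnType_of_seven_lt` (Manin-free there at `p ≥ 11` by Edixhoven; at the
additive `3` the datum is displayed). READING: at `3`, as at `p ≥ 5`, the law has no content beyond the
main-conjecture half of `BSD₃` on the type once the readings are granted. CONDITIONAL; nothing booked.
[cite: MatarNekovar2019, Thm. 0.3 and §0.11] [cite: EdixhovenManin1991, Thm. 3] [cite: Mazur1978, Cor. 4.1]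
[cite: Kobayashi2003, §4 (p. 8), Thm. 7.4 (p. 13)] [cite: Miller2011LMS, §1 and Def. 1.1] -/
theorem pairLawAtThree_iff_lowerHalfOnType_three
    (h₅ : (∀ (V : WeierstrassCurve ℚ) [V.IsElliptic] [V.IsGloballyMinimal], V.HasCM →
        V.HasGoodReductionAtPrime 3 → CMInert V 3 → QuadraticBranchPlusMainConjectureAt V 3) ∧
      ∀ (W : WeierstrassCurve ℚ) [W.IsElliptic] [W.IsGloballyMinimal],
        HasSignedLocalType W 3 (.Istar 0) → W.analyticRank = 1 →
        OddBranchStrictMinusNoFiniteSubmoduleAt W 3 ∧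
        ∀ (V : WeierstrassCurve ℚ) [V.IsElliptic] [V.IsGloballyMinimal] (C : VariableChange ℚ)
          {N : ℕ} [NeZero N] {f : CuspForm (Gamma0 N) 2},
          (3 : ℕ) ≠ 2 → C • W.quadraticTwist (-3) = V →
          V.HasGoodReductionAtPrime 3 → V.frobeniusTrace 3 = 0 →
          QuadraticBranchPlusMainConjectureAt V 3 → IsNewformOf V f →
          ∀ (ϖ : ℚ), (ϖ : ℝ) * V.imaginaryPeriodRat = minusPeriod f →
          ∀ (Lη : IwasawaAlgebra 3), IsQuadraticBranchMinusLFunction f 3 ϖ Lη →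
          ∀ (κ : ZpExtension ℚ 3) (γ : Field.absoluteGaloisGroup ℚ),
            κ.IsCyclotomic → κ.IsTopGenerator γ → IsCyclotomicVariable 3 γ →
          ∀ (D : StrictSignedSelmerDualData W κ ℚ_[3] γ (-1)) (L' : IwasawaAlgebra 3),
            Lη = PowerSeries.X * L' → D.charIdeal = Ideal.span {L'})
    (h₆ : PublishedFactsInert)
    (hGZ : ∀ (N : ℕ) [NeZero N] (W : WeierstrassCurve ℚ) (K : Type) [Field K] [NumberField K],
      gross_zagier N W K)
    (hKo : ∀ (N : ℕ) [NeZero N] (W : WeierstrassCurve ℚ) (K : Type) [Field K] [NumberField K],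
      kolyvagin N W K)
    (hMN : ∀ (N : ℕ) [NeZero N] (W : WeierstrassCurve ℚ) (K : Type) [Field K] [NumberField K],
      MatarNekovar2019.thm03_padicValNat_card_sha_le_of_irreducible N W K)
    (hFH : friedbergHoffstein_exists_heegnerField_split_twist_ne_zero)
    (hCM8 : bsdTriple_of_hasCM_of_L_one_ne_zero)
    (hManin : ∀ (W : WeierstrassCurve ℚ) [W.IsElliptic] [W.IsGloballyMinimal] [Fact (Nat.Prime 3)]
      [NeZero (W.conductorNorm ℤ)], HasSignedLocalType W 3 (.Istar 0) → W.analyticRank = 1 →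
      ∃ D : ModularParametrizationData W (W.conductorNorm ℤ), ¬ (3 : ℤ) ∣ D.c) :
    (∀ (W : WeierstrassCurve ℚ) [W.IsElliptic] [W.IsGloballyMinimal],
        HasSignedLocalType W 3 (.Istar 0) → W.analyticRank = 1 →
        ∀ (V : WeierstrassCurve ℚ) [V.IsElliptic] [V.IsGloballyMinimal] (C : VariableChange ℚ)
          {N : ℕ} [NeZero N] {f : CuspForm (Gamma0 N) 2},
          C • W.quadraticTwist (-3) = V →
          V.HasGoodReductionAtPrime 3 → V.frobeniusTrace 3 = 0 → IsNewformOf V f →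
          ∀ (ϖ : ℚ), (ϖ : ℝ) * V.imaginaryPeriodRat = minusPeriod f →
          ∀ (L : IwasawaAlgebra 3), IsQuadraticBranchMinusLFunction f 3 ϖ L →
          (∀ Q : (W.baseChange ℚ_[3]).toAffine.Point, 3 • Q = 0 → Q = 0) →
          ∀ (P : W.toAffine.Point) (n : ℕ), ¬ IsOfFinAddOrder P →
          (∀ R : W.toAffine.Point, ∃ (k : ℤ) (T : W.toAffine.Point),
            IsOfFinAddOrder T ∧ R = k • P + T) →
          (∃ Q : (W.baseChange ℚ_[3]).toAffine.Point, 3 ^ n • Q = W.toPadicPoint 3 P) →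
          (∀ Q : (W.baseChange ℚ_[3]).toAffine.Point, 3 ^ (n + 1) • Q ≠ W.toPadicPoint 3 P) →
          ∀ (q : ℚ), shaAn W = (q : ℂ) →
          PowerSeries.coeff 1 L ≠ 0 ∧
            ((PowerSeries.coeff 1 L : ℤ_[3]) : ℚ_[3]).valuation =
              2 * (n : ℤ) + padicValRat 3 (q * W.tamagawaProduct / (W.torsionOrder : ℚ) ^ 2)) ↔
      LowerHalfOnType 3 (.Istar 0) := by
  have h₆' := h₆
  obtain ⟨hmod, -, hGZK, -, hnf, -⟩ := h₆'
  rw [← inertBadAtThreeIstarZero_iff_pairLawAtThree h₅ h₆]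
  exact inertBadAtThreeIstarZero_iff_lowerHalfOnType_three hGZ hKo hMN hGZK hmod hnf hFH hCM8 hManin

end Summit.BirchSwinnertonDyer.BirchSwinnertonDyer.Theorems.InertBadAtThreeIff

end
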